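import Literature.Combinatorics.Optimization.CompletelyPsdRank
import Mathlib.Analysis.Matrix.PosDef
import Mathlib.LinearAlgebra.Trace
import HarnessLib

/-!
# A `5 × 5` matrix of cpsd-rank exactly `4` (Prakash–Sikora–Varvitsiotis–Wei 2017, Example 3.1)

Source: A. Prakash, J. Sikora, A. Varvitsiotis, Z. Wei, *Completely positive semidefinite rank*,
Math. Program. 171 (2018) 397–431 = arXiv:1604.07199 [PrakashEtAl2017], §3.1, Example 3.1 (held
text `paper:arxiv-1604.07199`, chunk p10). Vocabulary of `CompletelyPsdRank.lean`
(`HasCpsdFactorization X d` = "`cpsd-rank(X) ≤ d`"). Everything below is PROVED; no named facts.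

## The printed statement (p10, verbatim) and what is typed

"**Example 3.1.** We prove that the cpsd-rank of the matrix
`X = [2 0 0 1 1; 0 2 0 1 1; 0 0 2 1 1; 1 1 1 3 0; 1 1 1 0 3]` is equal to `4` and a size-optimal
`CS_+`-factorization is given by `diag(√2,0,0,0)`, `diag(0,1,1,0)`, `diag(0,0,0,√2)`,
`[1/√2 0 0 1/√2; 0 1 0 0; 0 0 0 0; 1/√2 0 0 1/√2]`, `[1/√2 0 0 −1/√2; 0 0 0 0; 0 0 1 0; −1/√2 0 0 1/√2]`.
Assume that `cpsd-rank(X) ≤ 3` and let `{P_i}_{i=1}^5 ⊆ H^3_+` be a `CS_+`-factorization. Since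
`P_1, P_2` and `P_3` commute pairwise, by applying an appropriate change of basis, we may assume by
Lemma 1 (i) that they are diagonal. Furthermore, as `⟨P_i,P_j⟩ = 0` for `i ≠ j ∈ [3]` it follows that
`P_i = √2 e_ie_iᵀ`, for `1 ≤ i ≤ 3`. Since `P_4, P_5` are `3 × 3` orthogonal psd matrices (and nonzero)
one of them has rank `1`. Suppose without loss of generality `P_4 = xx^*` for some `x ∈ ℂ³`. Note that
`|x_i|² = 1/√2` for all `1 ≤ i ≤ 3`. Thus `⟨P_4,P_4⟩ = (Σ|x_i|²)² = 9/2 ≠ 3`, a contradiction."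

Typed and PROVED: `psvwExample31` (the matrix), `hasCpsdFactorization_psvwExample31_four` (the
printed factors, checked entrywise), `not_hasCpsdFactorization_psvwExample31_three` and the summary
`PrakashEtAl2017_example31` (`cpsd-rank(X) = 4`: a size-`4` factorization exists and none of size
`≤ 3`). The lower bound is proved WITHOUT the simultaneous diagonalisation of the printed argument,
by trace inequalities valid in `H^3_+`: (a) `Tr(P)² ≥ Tr(P²)` for psd `P` (`2 × 2` principal
minors), so `Tr P_i ≥ √2` (`i ≤ 3`) and `T := P_1 + P_2 + P_3` has `Tr T ≥ 3√2` while `Tr(T²) = 6`;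
(b) `3·Tr(T²) − (Tr T)² = 3·Tr((T − (Tr T/3)I)²) = 3·Σ|entries|² ≥ 0`, whence `Tr T = 3√2` and
`T = √2·I₃` (the printed "`P_i = √2 e_ie_iᵀ`" summed); (c) then `√2·Tr P_4 = ⟨P_4, T⟩ = 3 = √2·Tr P_5`,
and the same identity for `S := P_4 + P_5` (`Tr S = 3√2`, `Tr(S²) = 6`) gives `P_4 + P_5 = √2·I₃`;
(d) `⟨P_4,P_5⟩ = 0` forces `P_4P_5 = 0` (Lemma 1 (ii)), so `P_4² = √2 P_4`, i.e. `P_4/√2` is a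
projection, whose trace `Tr P_4/√2 = 3/2` would have to be an integer (its rank) — the printed
contradiction "`9/2 ≠ 3`" in trace form.
-/

noncomputable section

open Matrix Finset
open scoped ComplexOrder MatrixOrder

namespace Literature.Combinatorics.Optimization

/-! ### The matrix and the printed size-4 factorization -/

/-- The matrix of Example 3.1. [cite: PrakashEtAl2017, Ex. 3.1 (p10)] -/
def psvwExample31 : Matrix (Fin 5) (Fin 5) ℝ :=
  !![2, 0, 0, 1, 1;
     0, 2, 0, 1, 1;
     0, 0, 2, 1, 1;
     1, 1, 1, 3, 0;
     1, 1, 1, 0, 3]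

/-- The coordinate vectors `e_k ∈ ℂ⁴` (real, so `star e_k = e_k`). [cite: PrakashEtAl2017, Ex. 3.1 (p10)] -/
private def ev (k : Fin 4) : Fin 4 → ℂ := Pi.single k 1

/-- `e_k` is real. [folklore] -/
private theorem star_ev (k : Fin 4) : star (ev k) = ev k := by
  funext j
  by_cases h : j = k
  · subst h; simp [ev]
  · simp [ev, h]

/-- `e_k + e_l` is real. [folklore] -/
private theorem star_ev_add (k l : Fin 4) : star (ev k + ev l) = ev k + ev l := by
  rw [star_add, star_ev, star_ev]

/-- `e_k − e_l` is real. [folklore] -/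
private theorem star_ev_sub (k l : Fin 4) : star (ev k - ev l) = ev k - ev l := by
  rw [star_sub, star_ev, star_ev]

/-- `e_k · e_l = δ_{kl}`. [folklore] -/
private theorem ev_dotProduct (k l : Fin 4) : ev k ⬝ᵥ ev l = if k = l then 1 else 0 := by
  simp [ev, Pi.single_apply, dotProduct, eq_comm]

/-- The printed factors, written as nonnegative combinations of outer products `vvᵀ` of real vectors:
`P_1 = √2 e_1e_1ᵀ`, `P_2 = e_2e_2ᵀ + e_3e_3ᵀ`, `P_3 = √2 e_4e_4ᵀ`,
`P_4 = (e_1+e_4)(e_1+e_4)ᵀ/√2 + e_2e_2ᵀ`, `P_5 = (e_1−e_4)(e_1−e_4)ᵀ/√2 + e_3e_3ᵀ` (these are the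
five printed `4 × 4` matrices). [cite: PrakashEtAl2017, Ex. 3.1 (p10)] -/
def psvwExample31Factor : Fin 5 → Matrix (Fin 4) (Fin 4) ℂ :=
  ![((Real.sqrt 2 : ℝ) : ℂ) • vecMulVec (ev 0) (ev 0),
    vecMulVec (ev 1) (ev 1) + vecMulVec (ev 2) (ev 2),
    ((Real.sqrt 2 : ℝ) : ℂ) • vecMulVec (ev 3) (ev 3),
    ((1 / Real.sqrt 2 : ℝ) : ℂ) • vecMulVec (ev 0 + ev 3) (ev 0 + ev 3) + vecMulVec (ev 1) (ev 1),
    ((1 / Real.sqrt 2 : ℝ) : ℂ) • vecMulVec (ev 0 - ev 3) (ev 0 - ev 3) + vecMulVec (ev 2) (ev 2)]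

/-- An outer product `vvᵀ` of a real vector, scaled by `c ≥ 0`, is psd. [folklore] -/
private theorem posSemidef_smul_vecMulVec {v : Fin 4 → ℂ} (hv : star v = v) {c : ℝ} (hc : 0 ≤ c) :
    (((c : ℝ) : ℂ) • vecMulVec v v).PosSemidef := by
  have h := posSemidef_vecMulVec_self_star v
  rw [hv] at h
  exact h.smul (Complex.zero_le_real.mpr hc)

/-- `e_ke_kᵀ ⪰ 0`. [folklore] -/
private theorem posSemidef_vecMulVec_ev (k : Fin 4) : (vecMulVec (ev k) (ev k)).PosSemidef := by
  have h := posSemidef_vecMulVec_self_star (ev k)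
  rwa [star_ev] at h

/-- The printed factors are (Hermitian) psd. [cite: PrakashEtAl2017, Ex. 3.1 (p10)] -/
theorem psvwExample31Factor_posSemidef (i : Fin 5) : (psvwExample31Factor i).PosSemidef := by
  have hs : (0 : ℝ) ≤ Real.sqrt 2 := Real.sqrt_nonneg 2
  have hs' : (0 : ℝ) ≤ 1 / Real.sqrt 2 := by positivity
  fin_cases i
  · exact posSemidef_smul_vecMulVec (star_ev 0) hs
  · exact (posSemidef_vecMulVec_ev 1).add (posSemidef_vecMulVec_ev 2)
  · exact posSemidef_smul_vecMulVec (star_ev 3) hs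
  · exact (posSemidef_smul_vecMulVec (star_ev_add 0 3) hs').add (posSemidef_vecMulVec_ev 1)
  · exact (posSemidef_smul_vecMulVec (star_ev_sub 0 3) hs').add (posSemidef_vecMulVec_ev 2)

/-- `Tr(uuᵀ · vvᵀ) = (u·v)²` for the vectors at hand. [folklore] -/
private theorem trace_vecMulVec_mul_vecMulVec_real (u v : Fin 4 → ℂ) :
    (vecMulVec u u * vecMulVec v v).trace = (u ⬝ᵥ v) * (u ⬝ᵥ v) := by
  rw [vecMulVec_mul_vecMulVec, trace_vecMulVec, dotProduct_smul, smul_eq_mul]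

/-- **`cpsd-rank(X) ≤ 4`**: the printed matrices form a `CS_+`-factorization of `X` of size `4`.
[cite: PrakashEtAl2017, Ex. 3.1 (p10)] -/
theorem hasCpsdFactorization_psvwExample31_four : HasCpsdFactorization psvwExample31 4 := by
  have hs2 : ((Real.sqrt 2 : ℝ) : ℂ) ^ 2 = 2 := by
    rw [← Complex.ofReal_pow, Real.sq_sqrt (by norm_num)]; norm_num
  have hs0 : ((Real.sqrt 2 : ℝ) : ℂ) ≠ 0 := by
    rw [Ne, Complex.ofReal_eq_zero]; exact (Real.sqrt_pos.mpr (by norm_num)).ne'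
  refine ⟨psvwExample31Factor, psvwExample31Factor_posSemidef, fun i j => ?_⟩
  have hd : ∀ k l : Fin 4, ev k ⬝ᵥ ev l = if k = l then 1 else 0 := ev_dotProduct
  fin_cases i <;> fin_cases j <;>
    simp [psvwExample31, psvwExample31Factor, Matrix.add_mul, Matrix.mul_add, trace_add,
      trace_smul, trace_vecMulVec_mul_vecMulVec_real, add_dotProduct, dotProduct_add,
      sub_dotProduct, dotProduct_sub, hd] <;>
    (try field_simp) <;> (try ring_nf) <;> (try simp only [hs2]) <;> (try norm_num)

/-! ### Trace inequalities in `H^d_+` -/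

section TraceLemmas

variable {d : ℕ}

/-- For Hermitian `M`: `Tr(M²) = Σ_{i,j} |M_ij|²`. [cite: PrakashEtAl2017, Ex. 3.1 (p10)] -/
theorem trace_mul_self_eq_sum_normSq {M : Matrix (Fin d) (Fin d) ℂ} (hM : M.IsHermitian) :
    (M * M).trace = ((∑ i, ∑ j, Complex.normSq (M i j) : ℝ) : ℂ) := by
  push_cast
  simp only [trace, diag_apply, mul_apply]
  refine Finset.sum_congr rfl fun i _ => Finset.sum_congr rfl fun j _ => ?_
  rw [← Complex.mul_conj, ← Complex.star_def, hM.apply j i]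

/-- For Hermitian `M`: `Tr(M²) = 0` forces `M = 0`. [cite: PrakashEtAl2017, Ex. 3.1 (p10)] -/
theorem eq_zero_of_trace_mul_self_eq_zero {M : Matrix (Fin d) (Fin d) ℂ} (hM : M.IsHermitian)
    (h : (M * M).trace = 0) : M = 0 := by
  rw [trace_mul_self_eq_sum_normSq hM, Complex.ofReal_eq_zero] at h
  have hrow := (Finset.sum_eq_zero_iff_of_nonneg fun i _ =>
    Finset.sum_nonneg fun j _ => Complex.normSq_nonneg (M i j)).mp h
  ext i j
  have hij := (Finset.sum_eq_zero_iff_of_nonneg fun j _ => Complex.normSq_nonneg (M i j)).mp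
    (hrow i (Finset.mem_univ i)) j (Finset.mem_univ j)
  exact Complex.normSq_eq_zero.mp hij

/-- A psd matrix has real nonnegative trace: `Tr P = (Tr P).re ≥ 0`. [folklore] -/
private theorem trace_eq_re_of_posSemidef {P : Matrix (Fin d) (Fin d) ℂ} (hP : P.PosSemidef) :
    P.trace = ((P.trace.re : ℝ) : ℂ) ∧ 0 ≤ P.trace.re := by
  obtain ⟨hre, him⟩ := Complex.nonneg_iff.mp hP.trace_nonneg
  exact ⟨Complex.ext (by simp) (by simp [← him]), hre⟩

/-- **`Tr(P²) ≤ (Tr P)²` for psd `P`** (all `2 × 2` principal minors `P_ii P_jj − |P_ij|²` are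
nonnegative and `Tr(P²) = Σ|P_ij|²`, `(Tr P)² = Σ P_ii P_jj`) — the eigenvalue-free form of
`Σ λ_i² ≤ (Σ λ_i)²`, `λ ≥ 0`. [cite: PrakashEtAl2017, Ex. 3.1 (p10)] -/
theorem re_trace_mul_self_le_sq {P : Matrix (Fin d) (Fin d) ℂ} (hP : P.PosSemidef) :
    ((P * P).trace).re ≤ (P.trace.re) ^ 2 := by
  classical
  -- diagonal entries are real
  have hdiag : ∀ i, P i i = (((P i i).re : ℝ) : ℂ) := fun i => by
    have h := hP.1.apply i i
    apply Complex.ext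
    · simp
    · have : (P i i).im = -(P i i).im := by
        conv_lhs => rw [← h]
        simp
      simp only [Complex.ofReal_im]
      linarith
  -- the `2 × 2` minors
  have hminor : ∀ i j, Complex.normSq (P i j) ≤ (P i i).re * (P j j).re := fun i j => by
    have h := (hP.submatrix ![i, j]).det_nonneg
    rw [det_fin_two] at h
    simp only [submatrix_apply, Matrix.cons_val_zero, Matrix.cons_val_one] at h
    have hji : P j i = star (P i j) := (hP.1.apply j i).symm
    rw [hji, Complex.star_def, Complex.mul_conj, hdiag i, hdiag j, ← Complex.ofReal_mul,
      ← Complex.ofReal_sub, Complex.zero_le_real] at h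
    linarith
  rw [trace_mul_self_eq_sum_normSq hP.1, Complex.ofReal_re]
  have htr : P.trace.re = ∑ i, (P i i).re := by
    simp only [trace, diag_apply, Complex.re_sum]
  rw [htr, sq, Finset.sum_mul_sum]
  exact Finset.sum_le_sum fun i _ => Finset.sum_le_sum fun j _ => hminor i j

/-- `Tr(P Q) = 0` forces `P Q = 0` for Hermitian psd complex `P, Q` (PSVW Lemma 1 (ii); private copy
of the `CompletelyPsdRank.lean` lemma: `Q = CᴴC`, `Tr(P CᴴC) = Σ_l c̄_lᵀ P c̄_l ≥ 0` termwise).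
[cite: PrakashEtAl2017, Lemma 1 (ii) (p08)] -/
private theorem mul_eq_zero_of_trace_mul_eq_zero {P Q : Matrix (Fin d) (Fin d) ℂ}
    (hP : P.PosSemidef) (hQ : Q.PosSemidef) (h : (P * Q).trace = 0) : P * Q = 0 := by
  classical
  obtain ⟨C, hC⟩ := CStarAlgebra.nonneg_iff_eq_star_mul_self.mp hQ.nonneg
  have hQC : Q = Cᴴ * C := by rw [hC, star_eq_conjTranspose]
  have hsum : (P * Q).trace = ∑ l, star (star (C l)) ⬝ᵥ (P *ᵥ star (C l)) := by
    rw [hQC, ← Matrix.mul_assoc, Matrix.trace_mul_comm]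
    simp only [Matrix.trace, Matrix.diag_apply, Matrix.mul_apply, Matrix.conjTranspose_apply,
      dotProduct, Matrix.mulVec, Finset.mul_sum, star_star, Pi.star_apply]
  have hnn : ∀ l, 0 ≤ star (star (C l)) ⬝ᵥ (P *ᵥ star (C l)) := fun l =>
    hP.dotProduct_mulVec_nonneg (star (C l))
  have hzero : ∀ l, star (star (C l)) ⬝ᵥ (P *ᵥ star (C l)) = 0 := by
    have h0 : ∑ l, star (star (C l)) ⬝ᵥ (P *ᵥ star (C l)) = 0 := by rw [← hsum, h]
    exact fun l => (Finset.sum_eq_zero_iff_of_nonneg fun l _ => hnn l).1 h0 l (Finset.mem_univ l)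
  have hker : ∀ l, P *ᵥ star (C l) = 0 := fun l => (hP.dotProduct_mulVec_zero_iff _).1 (hzero l)
  have hPCh : P * Cᴴ = 0 := by
    ext s l
    have := congrFun (hker l) s
    simpa only [Matrix.mul_apply, Matrix.conjTranspose_apply, Matrix.mulVec, dotProduct,
      Matrix.zero_apply, Pi.zero_apply, Pi.star_apply] using this
  rw [hQC, ← Matrix.mul_assoc, hPCh, Matrix.zero_mul]

/-- The centring identity `Tr((M − cI)²) = Tr(M²) − 2c·Tr M + d·c²`. [cite: PrakashEtAl2017, Ex. 3.1 (p10)] -/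
theorem trace_sub_smul_one_mul_self (M : Matrix (Fin d) (Fin d) ℂ) (c : ℂ) :
    ((M - c • (1 : Matrix (Fin d) (Fin d) ℂ)) * (M - c • 1)).trace =
      (M * M).trace - 2 * c * M.trace + d * c ^ 2 := by
  simp only [sub_mul, mul_sub, Matrix.smul_mul, Matrix.mul_smul, Matrix.one_mul, Matrix.mul_one,
    trace_sub, trace_smul, smul_eq_mul, trace_one, Fintype.card_fin, smul_smul]
  ring

/-- **A Hermitian `3 × 3` matrix with `Tr(M²) = 6` and `Tr M = 3√2` is `√2·I`** (equality in
`(Tr M)² ≤ 3·Tr(M²)`): `Tr((M − √2 I)²) = 6 − 2√2·3√2 + 3·2 = 0`. [cite: PrakashEtAl2017, Ex. 3.1 (p10)] -/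
theorem eq_sqrt_two_smul_one {M : Matrix (Fin 3) (Fin 3) ℂ} (hM : M.IsHermitian)
    (h2 : (M * M).trace = 6) (h1 : M.trace = 3 * ((Real.sqrt 2 : ℝ) : ℂ)) :
    M = ((Real.sqrt 2 : ℝ) : ℂ) • (1 : Matrix (Fin 3) (Fin 3) ℂ) := by
  have hs2 : ((Real.sqrt 2 : ℝ) : ℂ) ^ 2 = 2 := by
    rw [← Complex.ofReal_pow, Real.sq_sqrt (by norm_num)]; norm_num
  have hH : (M - ((Real.sqrt 2 : ℝ) : ℂ) • (1 : Matrix (Fin 3) (Fin 3) ℂ)).IsHermitian := by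
    refine hM.sub ?_
    rw [IsHermitian, conjTranspose_smul, conjTranspose_one, Complex.star_def, Complex.conj_ofReal]
  have h0 : ((M - ((Real.sqrt 2 : ℝ) : ℂ) • (1 : Matrix (Fin 3) (Fin 3) ℂ)) *
      (M - ((Real.sqrt 2 : ℝ) : ℂ) • 1)).trace = 0 := by
    rw [trace_sub_smul_one_mul_self, h2, h1]
    push_cast
    linear_combination (-3 : ℂ) * hs2
  exact sub_eq_zero.mp (eq_zero_of_trace_mul_self_eq_zero hH h0)

/-- The trace of a Hermitian idempotent (projection) matrix is a natural number — its rank.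
[folklore] -/
private theorem trace_eq_natCast_of_idempotent {E : Matrix (Fin d) (Fin d) ℂ} (hE : E * E = E) :
    ∃ k : ℕ, E.trace = k := by
  classical
  have hid : IsIdempotentElem (Matrix.toLin' E) := by
    rw [IsIdempotentElem, Module.End.mul_eq_comp, ← Matrix.toLin'_mul, hE]
  refine ⟨Module.finrank ℂ (LinearMap.range (Matrix.toLin' E)), ?_⟩
  rw [← Matrix.trace_toLin'_eq, (LinearMap.IsIdempotentElem.isProj_range _ hid).trace]

end TraceLemmas

/-! ### The lower bound: no `CS_+`-factorization of size `3` -/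

/-- **`cpsd-rank(X) > 3`**: `X` has no `CS_+`-factorization by `3 × 3` Hermitian psd matrices
(hence none of any size `≤ 3`, `HasCpsdFactorization.mono`). [cite: PrakashEtAl2017, Ex. 3.1 (p10)] -/
theorem not_hasCpsdFactorization_psvwExample31_three : ¬ HasCpsdFactorization psvwExample31 3 := by
  rintro ⟨P, hP, hX⟩
  -- notation and the entries of `X` that are used
  set r : ℂ := ((Real.sqrt 2 : ℝ) : ℂ) with hr
  have hs2 : r ^ 2 = 2 := by
    rw [hr, ← Complex.ofReal_pow, Real.sq_sqrt (by norm_num)]; norm_num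
  have hsR : Real.sqrt 2 * Real.sqrt 2 = 2 := Real.mul_self_sqrt (by norm_num)
  have hsRpos : 0 < Real.sqrt 2 := Real.sqrt_pos.mpr (by norm_num)
  have e : ∀ i j, (P i * P j).trace = ((psvwExample31 i j : ℝ) : ℂ) := fun i j => (hX i j).symm
  have t00 : (P 0 * P 0).trace = 2 := by rw [e]; simp [psvwExample31]
  have t11 : (P 1 * P 1).trace = 2 := by rw [e]; simp [psvwExample31]
  have t22 : (P 2 * P 2).trace = 2 := by rw [e]; simp [psvwExample31]
  have t01 : (P 0 * P 1).trace = 0 := by rw [e]; simp [psvwExample31]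
  have t02 : (P 0 * P 2).trace = 0 := by rw [e]; simp [psvwExample31]
  have t10 : (P 1 * P 0).trace = 0 := by rw [e]; simp [psvwExample31]
  have t12 : (P 1 * P 2).trace = 0 := by rw [e]; simp [psvwExample31]
  have t20 : (P 2 * P 0).trace = 0 := by rw [e]; simp [psvwExample31]
  have t21 : (P 2 * P 1).trace = 0 := by rw [e]; simp [psvwExample31]
  have t30 : (P 3 * P 0).trace = 1 := by rw [e]; simp [psvwExample31]
  have t31 : (P 3 * P 1).trace = 1 := by rw [e]; simp [psvwExample31]
  have t32 : (P 3 * P 2).trace = 1 := by rw [e]; simp [psvwExample31]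
  have t40 : (P 4 * P 0).trace = 1 := by rw [e]; simp [psvwExample31]
  have t41 : (P 4 * P 1).trace = 1 := by rw [e]; simp [psvwExample31]
  have t42 : (P 4 * P 2).trace = 1 := by rw [e]; simp [psvwExample31]
  have t33 : (P 3 * P 3).trace = 3 := by rw [e]; simp [psvwExample31]
  have t44 : (P 4 * P 4).trace = 3 := by rw [e]; simp [psvwExample31]
  have t34 : (P 3 * P 4).trace = 0 := by rw [e]; simp [psvwExample31]
  have t43 : (P 4 * P 3).trace = 0 := by rw [e]; simp [psvwExample31]
  -- (a) `Tr P_i ≥ √2` for `i ≤ 3`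
  have hge : ∀ i, (P i * P i).trace = 2 → (P i).trace = (((P i).trace.re : ℝ) : ℂ) ∧
      Real.sqrt 2 ≤ (P i).trace.re := by
    intro i hi
    obtain ⟨hre, hnn⟩ := trace_eq_re_of_posSemidef (hP i)
    have hsq := re_trace_mul_self_le_sq (hP i)
    rw [hi] at hsq
    norm_num at hsq
    have hle : Real.sqrt 2 ≤ (P i).trace.re := by
      rw [show (P i).trace.re = Real.sqrt ((P i).trace.re ^ 2) by rw [Real.sqrt_sq hnn]]
      exact Real.sqrt_le_sqrt hsq
    exact ⟨hre, hle⟩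
  obtain ⟨h0re, h0⟩ := hge 0 t00
  obtain ⟨h1re, h1⟩ := hge 1 t11
  obtain ⟨h2re, h2⟩ := hge 2 t22
  -- (b) `T = P₀ + P₁ + P₂ = √2 I`
  set T := P 0 + P 1 + P 2 with hT
  have hTH : T.IsHermitian := ((hP 0).1.add (hP 1).1).add (hP 2).1
  have hT2 : (T * T).trace = 6 := by
    simp only [hT, add_mul, mul_add, trace_add, t00, t01, t02, t10, t11, t12, t20, t21, t22]
    norm_num
  set t : ℝ := (P 0).trace.re + (P 1).trace.re + (P 2).trace.re with ht
  have hTt : T.trace = ((t : ℝ) : ℂ) := by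
    rw [ht]
    push_cast
    rw [← h0re, ← h1re, ← h2re, hT, trace_add, trace_add]
  have htge : 3 * Real.sqrt 2 ≤ t := by rw [ht]; linarith
  -- `3·Tr(T²) − (Tr T)² = 3·Σ|(T − (t/3)I)_ij|² ≥ 0`
  have hTc : (T - ((t / 3 : ℝ) : ℂ) • (1 : Matrix (Fin 3) (Fin 3) ℂ)).IsHermitian := by
    refine hTH.sub ?_
    rw [IsHermitian, conjTranspose_smul, conjTranspose_one, Complex.star_def, Complex.conj_ofReal]
  have hid := trace_sub_smul_one_mul_self T (((t / 3 : ℝ) : ℂ))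
  rw [trace_mul_self_eq_sum_normSq hTc, hT2, hTt] at hid
  have hnn : 0 ≤ ∑ i, ∑ j,
      Complex.normSq ((T - ((t / 3 : ℝ) : ℂ) • (1 : Matrix (Fin 3) (Fin 3) ℂ)) i j) :=
    Finset.sum_nonneg fun i _ => Finset.sum_nonneg fun j _ => Complex.normSq_nonneg _
  have hidR : ∑ i, ∑ j, Complex.normSq ((T - ((t / 3 : ℝ) : ℂ) • (1 : Matrix (Fin 3) (Fin 3) ℂ)) i j)
      = 6 - 2 * (t / 3) * t + 3 * (t / 3) ^ 2 := by exact_mod_cast hid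
  have ht2 : t ^ 2 ≤ 18 := by nlinarith [hnn, hidR]
  have hteq : t = 3 * Real.sqrt 2 := by nlinarith [htge, ht2, hsR, hsRpos]
  have hTeq : T = r • (1 : Matrix (Fin 3) (Fin 3) ℂ) := by
    refine eq_sqrt_two_smul_one hTH hT2 ?_
    rw [hTt, hteq]; push_cast; rfl
  -- (c) `√2 Tr P₃ = 3 = √2 Tr P₄`, and `P₃ + P₄ = √2 I`
  have hq : r * (P 3).trace = 3 := by
    have h := congrArg Matrix.trace (show P 3 * T = P 3 * P 0 + P 3 * P 1 + P 3 * P 2 by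
      simp only [hT, mul_add])
    rw [trace_add, trace_add, t30, t31, t32, hTeq, Matrix.mul_smul, Matrix.mul_one, trace_smul,
      smul_eq_mul] at h
    rw [h]; norm_num
  have hq' : r * (P 4).trace = 3 := by
    have h := congrArg Matrix.trace (show P 4 * T = P 4 * P 0 + P 4 * P 1 + P 4 * P 2 by
      simp only [hT, mul_add])
    rw [trace_add, trace_add, t40, t41, t42, hTeq, Matrix.mul_smul, Matrix.mul_one, trace_smul,
      smul_eq_mul] at h
    rw [h]; norm_num
  have hr0 : r ≠ 0 := by
    rw [hr, Ne, Complex.ofReal_eq_zero]; exact hsRpos.ne'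
  set S := P 3 + P 4 with hS
  have hSH : S.IsHermitian := (hP 3).1.add (hP 4).1
  have hS2 : (S * S).trace = 6 := by
    simp only [hS, add_mul, mul_add, trace_add, t33, t34, t43, t44]
    norm_num
  have hS1 : S.trace = 3 * r := by
    have h3 : r * S.trace = 6 := by
      simp only [hS, trace_add, mul_add, hq, hq']; norm_num
    -- `S.trace = 6 / r = 3 r` since `r² = 2`
    have : r * S.trace = r * (3 * r) := by rw [h3]; linear_combination (-3 : ℂ) * hs2
    exact mul_left_cancel₀ hr0 this
  have hSeq : S = r • (1 : Matrix (Fin 3) (Fin 3) ℂ) := eq_sqrt_two_smul_one hSH hS2 hS1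
  -- (d) `P₃ P₄ = 0`, so `P₃² = √2 P₃`: `P₃/√2` is a projection of trace `3/2`
  have h34 : P 3 * P 4 = 0 := mul_eq_zero_of_trace_mul_eq_zero (hP 3) (hP 4) t34
  have hP3sq : P 3 * P 3 = r • P 3 := by
    have h : P 3 * S = P 3 * P 3 := by rw [hS, mul_add, h34, add_zero]
    rw [← h, hSeq, Matrix.mul_smul, Matrix.mul_one]
  set E := r⁻¹ • P 3 with hE
  have hEE : E * E = E := by
    rw [hE, Matrix.smul_mul, Matrix.mul_smul, hP3sq, smul_smul, smul_smul]
    congr 1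
    rw [mul_assoc, inv_mul_cancel₀ hr0, mul_one]
  obtain ⟨k, hk⟩ := trace_eq_natCast_of_idempotent hEE
  have htrP3 : (P 3).trace = r * k := by
    have : (P 3).trace = r * E.trace := by
      rw [hE, trace_smul, smul_eq_mul, ← mul_assoc, mul_inv_cancel₀ hr0, one_mul]
    rw [this, hk]
  -- `√2 · √2 k = 3`, i.e. `2k = 3`: impossible
  rw [htrP3, ← mul_assoc, ← sq, hs2] at hq
  have hnat : (2 * k : ℕ) = 3 := by exact_mod_cast hq
  omega

/-- **PSVW Example 3.1** (p10): `cpsd-rank(X) = 4` — `X` has a `CS_+`-factorization of size `4`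
(the printed one) and none of size `3` (hence none of any size `≤ 3`).
[cite: PrakashEtAl2017, Ex. 3.1 (p10)] -/
theorem PrakashEtAl2017_example31 :
    HasCpsdFactorization psvwExample31 4 ∧ ∀ d ≤ 3, ¬ HasCpsdFactorization psvwExample31 d :=
  ⟨hasCpsdFactorization_psvwExample31_four,
    fun _ hd h => not_hasCpsdFactorization_psvwExample31_three (h.mono hd)⟩

end Literature.Combinatorics.Optimization
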